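import Summits.NavierStokesRegularity.NavierStokesRegularity.Theorems.OddMorawetzLocal.Negative.OddMorawetzLocalRefutationDefsIV

/-!
# Crux `OddMorawetzLocal` (stmt-NavierStokesRegularity-1376) — refutation vocabulary V: certificate index maps with
literal sizes

Definitions only. The abstract rank-certificate lemma `kernel_eq_span_of_modular_certificate` is applied with index
types `Fin r`, `Fin d` for LITERAL `r, d` (147/50 at weight 5, 23/17 at weight 3); the objects below read the literal
certificate lists with `ℕ` indices (`getD`), so that no length casts are needed: `certIdx` (a list of naturals as a
map `Fin r → Fin n`), `certBd` (block-diagonal inverse, any size), `certCd` (an inverse block, any size), `sVecD`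
(isotropic basis element in orbit coordinates, `ℕ`-indexed descriptor list), and the kernel check
`blockShapesDisjoint` (rows of one certificate block and columns of another never share a shape — the off-diagonal
blocks of the minor vanish).
-/

set_option linter.dupNamespace false
set_option autoImplicit false

namespace Summit.NavierStokesRegularity.NavierStokesRegularity.Theorems.OddMorawetz

/-- A list of naturals as an index map `Fin r → Fin n` (entries reduced mod `n`; out-of-range positions read `0`). -/
def certIdx (l : List ℕ) (n r : ℕ) (hn : 0 < n) : Fin r → Fin n := fun t => ⟨l.getD t.val 0 % n, Nat.mod_lt _ hn⟩

/-- The block-diagonal inverse of the certificate minor mod `p`, as an `r × r` matrix for a literal `r`. -/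
def certBd (blocks : List (List ℕ × List ℕ × List (List ℕ))) (p r : ℕ) : Matrix (Fin r) (Fin r) (ZMod p) :=
  Matrix.of fun s t => (certInvEntry blocks s.val t.val : ZMod p)

/-- An inverse block given by rows, as a `d × d` matrix mod `p` for a literal `d`. -/
def certCd (cinv : List (List ℕ)) (p d : ℕ) : Matrix (Fin d) (Fin d) (ZMod p) :=
  Matrix.of fun a b => ((cinv.getD a.val []).getD b.val 0 : ZMod p)

/-- The isotropic basis element `l` (descriptor list read with `getD`) in orbit coordinates. -/
def sVecD (reps : List (List JVar)) (iso : List IsoDesc) (d : ℕ) (l : Fin d) : Fin reps.length → ℤ :=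
  fun r => JPoly.coeffOf (isoPolyF (iso.getD l.val (.poly []))) (reps.get r)

/-- Kernel check: for every ordered pair of distinct certificate blocks, no row monomial of the first has the shape of a
column representative of the second (so those minor entries vanish: the derivation preserves shapes). -/
def blockShapesDisjoint (k : ℕ) (reps : List (List JVar)) (blocks : List (List ℕ × List ℕ × List (List ℕ))) : Bool :=
  (List.range blocks.length).all fun β => (List.range blocks.length).all fun β' =>
    β = β' || ((blocks.getD β ([], [], [])).1.all fun i => (blocks.getD β' ([], [], [])).2.1.all fun c =>
      decide (shapeOf ((idx k).getD i []) ≠ shapeOf (reps.getD c [])))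

/-- Kernel check of the index ranges of the certificate data: rows `< (idx k).length`, columns and `kcols`
`< reps.length`, inverse blocks square of the block size, one column per row. -/
def certRangesOk (k : ℕ) (reps : List (List JVar)) (blocks : List (List ℕ × List ℕ × List (List ℕ))) (kcols : List ℕ)
    (cinv : List (List ℕ)) (d : ℕ) : Bool :=
  (blocks.all fun b => (b.1.all fun i => decide (i < (idx k).length)) && (b.2.1.all fun c => decide (c < reps.length)) &&
      decide (b.2.1.length = b.1.length) && decide (b.2.2.length = b.1.length) &&
      b.2.2.all fun row => decide (row.length = b.1.length)) &&
    (kcols.all fun c => decide (c < reps.length)) && decide (kcols.length = d) && decide (cinv.length = d) &&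
    cinv.all fun row => decide (row.length = d)

end Summit.NavierStokesRegularity.NavierStokesRegularity.Theorems.OddMorawetz
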